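import Mathlib
import Summits.Ventures.HodgeRepro2.T6NAut2Toy
import Summits.Ventures.HodgeRepro2.T6N3Main2
import Summits.Ventures.HodgeRepro2.T6N2ToyIso

/-!
# T6N2ToyJoint — the lead's v2 toy with the explicit-isometry N2 datum: the seven binders of
`periodInputN_of_mains₂` hold jointly with NO hypothesis (README §10.5(ii)(d); owner t6-p5)

The lead's T6NAut2Toy is PARAMETRIC in the N2 datum: `NAut2Toy.exists_joint₂ F d2 hAdm hAll` and
`NAut2Toy.toy_periodInputN_of_mains₂ F hw hw0 d2 hAdm hAll` take any admissible N2 datum over the toy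
N3 datum `N3Toy.toy` with every quadruple admissible. This file plugs in T6N2ToyIso's datum
`toyIsoF` (the isometry written down; `toyIsoF_adm` has no hypothesis; admissible sets `Set.univ`):
`exists_joint₂ F` — for every face setting of the CM field `K`, some period datum and some v2
carrier satisfy the seven binders of `periodInputN_of_mains₂` jointly, N2's `AdmDatum` INCLUDED, with
nothing assumed; and `toy_periodInputN_of_mains₂` — the v2 composition fires on the toy. The
§10.5(ii)(d) report of N2 on the v2 line: «joint, no residual» (it read «joint modulo the Shimura
display» with T6N2Toy's datum, t6-lead l. 5321). For the M2 v4 line (t6-p3's `N3iso_main₂`, whose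
binder `hAdm : M.d2.AdmGenerating` is the sentence N2 and N3 share — TIER4 Lemma A7.3(b): the vertex
forms of the admissible data generate the vertex forms, t6-p3 l. 5414 / l. 10901) the datum also
carries `d2_admSpanning` / `d2_admGenerating` outright (admissible sets `Set.univ`, t6-p3's
`admSpanning_of_univ` / `admGenerating_of_admSpanning`).

README §8(d): uses an L-value-free non-vanishing device: NO (TIER5 §N2, a pre-02:16Z line of
record — N2 asserts no non-vanishing — continued).
-/

namespace Summit.Ventures.HodgeRepro2.T6.N2ToyJoint

open scoped InnerProductSpace

variable {K : Type} [Field K] [NumberField K] [NumberField.IsCMField K]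

/-- The explicit-isometry N2 datum over the toy N3 datum, indexed by any period datum `P₀` (the
lead's `N2Datum.reindex` moves the index). -/
noncomputable def d2 (F : FaceSetting K) (P₀ : NDatum F) : N2Datum F P₀ N3Toy.toy :=
  N2ToyIso.toyIsoF F P₀ N3Toy.toy

/-- `Adm` with no hypothesis. -/
theorem d2_adm (F : FaceSetting K) (P₀ : NDatum F) : (d2 F P₀).Adm :=
  N2ToyIso.toyIsoF_adm F P₀ N3Toy.toy

/-- Every quadruple is admissible data. -/
theorem d2_admData (F : FaceSetting K) (P₀ : NDatum F)
    (φ : N3Toy.toy.A.Sa × N3Toy.toy.A.Sb × N3Toy.toy.B.Sa × N3Toy.toy.B.Sb) :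
    (d2 F P₀).AdmData φ :=
  N2ToyIso.toyIso_admData F P₀ N3Toy.toy _ φ

/-- `AdmSpanning` (t6-p3's T6N3Adm): the admissible sets span — they are `Set.univ`. -/
theorem d2_admSpanning (F : FaceSetting K) (P₀ : NDatum F) : (d2 F P₀).AdmSpanning :=
  N2Datum.admSpanning_of_univ _ rfl rfl rfl rfl

/-- `AdmGenerating` (t6-p3's T6N3Main2 §1 — the sentence N2 and N3 share, the binder `hAdm` of
`N3iso_main₂` on the M2 v4 line): outright on the toy datum. -/
theorem d2_admGenerating (F : FaceSetting K) (P₀ : NDatum F) : (d2 F P₀).AdmGenerating :=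
  N2Datum.admGenerating_of_admSpanning _ (d2_admSpanning F P₀)

/-- JOINT CONSISTENCY OF THE v2 COMPOSITION'S HYPOTHESES WITH NO HYPOTHESIS: for every face setting
`F` some period datum and some v2 carrier satisfy the seven binders of `periodInputN_of_mains₂`
jointly — N2's `AdmDatum` by the explicit isometry. -/
theorem exists_joint₂ (F : FaceSetting K) :
    ∃ (P : NDatum F) (M : NAut2 F P),
      (∀ c, P.AdmChoice c → M.pairing c ≠ 0 → P.I P.τ₁ c ≠ 0) ∧ M.AdmDatum ∧
      (M.iA → M.iiA → M.ellA) ∧ (M.iB → M.iiB → M.ellB) ∧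
      (M.ellA → M.ellB → ∃ (φa : M.d3.A.Sa) (φb : M.d3.A.Sb) (φc : M.d3.B.Sa) (φd : M.d3.B.Sb),
        M.AdmData (φa, φb, φc, φd) ∧ ⟪M.d3.B.F φc φd, M.d3.A.F φa φb⟫_ℂ ≠ 0) ∧
      (M.iA ∧ M.iB) ∧ M.N5 := by
  obtain ⟨σ, w, hw, hw0⟩ := ToyN.exists_eigenvector_KC K
  exact NAut2Toy.exists_joint₂ F (d2 F (NAutToyN.toyNDatumN F hw hw0)) (d2_adm _ _)
    (d2_admData _ _)

/-- The v2 composition fires on the lead's toy with the explicit-isometry datum: every binder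
instantiated, nothing assumed. -/
theorem toy_periodInputN_of_mains₂ (F : FaceSetting K) {σ : K →+* ℂ} {w : KC K}
    (hw : w ∈ eigenLineK K σ) (hw0 : w ≠ 0) :
    ∃ c, (NAutToyN.toyNDatumN F hw hw0).AdmChoice c ∧
      Hyp.PeriodN ((NAutToyN.toyNDatumN F hw hw0).shadow c) :=
  NAut2Toy.toy_periodInputN_of_mains₂ F hw hw0 (d2 F (NAutToyN.toyNDatumN F hw hw0))
    (d2_adm _ _) (d2_admData _ _)

end Summit.Ventures.HodgeRepro2.T6.N2ToyJoint
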